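import Summits.SmoothPoincare4.SmoothPoincare4.Theorems.SymplecticOrigamiGromovRecognitionRelEndStubReadSigmaAux1
import Literature.Geometry.Symplectic.AlmostComplexStructure

/-!
# Reading the bi-foliation chart `σ` — the hypotheses, the labels, the map `σ`
(stub `stub_readSigma` of line `cross-cap-laurent`, crux `SymplecticOrigami.GromovRecognitionRelEnd`,
item stmt-SmoothPoincare4-11009; second auxiliary file)

* `SigmaHyp`: the hypotheses of the stub (cap block of the wedge cap `X = ι(M) ⊔ (H∞ ∪ V∞)`, the
  two retractions `lamV`, `lamH` of the bi-foliation core with all their properties, the wedge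
  facts and the flat-leaf identities), bundled as a record of proofs.
* the inverse cap charts `θH = (ηH|D_H)⁻¹`, `θV = (ηV|D_V)⁻¹` and their smoothness on the images;
* the labels: for `y` off `V∞` (i.e. `lamV y ≠ ηC 0`), `lamV y = ηH p` with `p` on the axis, so
  `θH (lamV y)` is that `p`; points of `ι(M)` are off `V∞ ∪ H∞`; points off `V∞ ∪ H∞` are in `ι(M)`;
* the chart `Φ y = P01 (θH (lamV y)) + P23 (θV (lamH y))` on `X` and `σf = Φ ∘ ι : M → ℝ⁴`,
  smooth (bijectivity and the differential are in the third file).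
-/

noncomputable section

-- the registered namespace `Summit.SmoothPoincare4.SmoothPoincare4.Theorems…` repeats a component
set_option linter.dupNamespace false

open scoped Manifold ContDiff Topology
open Set Function Filter Literature.Geometry.Symplectic

namespace Summit.SmoothPoincare4.SmoothPoincare4.Theorems.GromovRecognitionRelEnd.CrossCapLaurent

namespace ReadSigma

open CapModel

/-- Model space `ℝ⁴ = ℂ²` (coordinates `0,1` = `z₁`, `2,3` = `z₂`). -/
local notation "E4" => EuclideanSpace ℝ (Fin 4)

/-! ## The hypotheses of the stub, bundled -/

/-- **The hypotheses of `stub_readSigma`** (those actually used): the cap block of `stub_capModel`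
for `(X, JX, ι, ηH, ηV, ηC)`, the seventeen properties of the two retractions `lamV`, `lamH`
output by `stub_biFoliationCore`, the three wedge facts of `stub_wedgeDisjoint` and the two
flat-leaf identities of `stub_flatLeaves`; a record of proofs (data-free, in `Type` like
`CapModel.EndHyp`), used only to shorten the signatures of the lemmas of this construction.
[folklore] -/
structure SigmaHyp {M X : Type*} [TopologicalSpace M] [ChartedSpace E4 M] [IsManifold (𝓡 4) ∞ M]
    [TopologicalSpace X] [ChartedSpace E4 X] [IsManifold (𝓡 4) ∞ X]
    (J : AlmostComplexStructure (𝓡 4) ∞ M) (JX : AlmostComplexStructure (𝓡 4) ∞ X)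
    (ι : M → X) (ηH ηV ηC : E4 → X) (χ : E4 → M) (R₁ : ℝ) (lamV lamH : X → X) : Type where
  /-- `0 < R₁` -/
  R₁_pos : 0 < R₁
  /-- `ι` is a local diffeomorphism -/
  ι_locDiff : IsLocalDiffeomorph (𝓡 4) (𝓡 4) ∞ ι
  /-- `ι` is injective -/
  ι_inj : Injective ι
  /-- `ι` is `(J, JX)`-holomorphic -/
  ι_J : ∀ (x : M) (v : TangentSpace (𝓡 4) x),
    JX (ι x) (mfderiv (𝓡 4) (𝓡 4) ι x v) = mfderiv (𝓡 4) (𝓡 4) ι x (J x v)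
  /-- `ηV` is a local diffeomorphism on `D_V` -/
  ηV_locDiff : IsLocalDiffeomorphOn 𝓘(ℝ, E4) (𝓡 4) ∞ ηV {p : E4 | p 0 ^ 2 + p 1 ^ 2 < R₁⁻¹ ^ 2}
  /-- `ηV` is injective on `D_V` -/
  ηV_inj : InjOn ηV {p : E4 | p 0 ^ 2 + p 1 ^ 2 < R₁⁻¹ ^ 2}
  /-- gluing of `ηV` to the end off the axis -/
  ηV_glue : ∀ p : E4, p 0 ^ 2 + p 1 ^ 2 < R₁⁻¹ ^ 2 → (p 0 ≠ 0 ∨ p 1 ≠ 0) →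
    ηV p = ι (χ (WithLp.toLp 2 ![p 0 / (p 0 ^ 2 + p 1 ^ 2), -(p 1) / (p 0 ^ 2 + p 1 ^ 2), p 2, p 3]))
  /-- the axis of `ηV` is new -/
  ηV_axis : ∀ p : E4, p 0 = 0 → p 1 = 0 → ηV p ∉ range ι
  /-- `ηV` is holomorphic for `i ⊕ i` -/
  ηV_J : ∀ p : E4, p 0 ^ 2 + p 1 ^ 2 < R₁⁻¹ ^ 2 → ∀ q : E4,
    JX (ηV p) (mfderiv 𝓘(ℝ, E4) (𝓡 4) ηV p q) =
      mfderiv 𝓘(ℝ, E4) (𝓡 4) ηV p (WithLp.toLp 2 ![-(q 1), q 0, -(q 3), q 2])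
  /-- `ηH` is a local diffeomorphism on `D_H` -/
  ηH_locDiff : IsLocalDiffeomorphOn 𝓘(ℝ, E4) (𝓡 4) ∞ ηH {p : E4 | p 2 ^ 2 + p 3 ^ 2 < R₁⁻¹ ^ 2}
  /-- `ηH` is injective on `D_H` -/
  ηH_inj : InjOn ηH {p : E4 | p 2 ^ 2 + p 3 ^ 2 < R₁⁻¹ ^ 2}
  /-- gluing of `ηH` to the end off the axis -/
  ηH_glue : ∀ p : E4, p 2 ^ 2 + p 3 ^ 2 < R₁⁻¹ ^ 2 → (p 2 ≠ 0 ∨ p 3 ≠ 0) →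
    ηH p = ι (χ (WithLp.toLp 2 ![p 0, p 1, p 2 / (p 2 ^ 2 + p 3 ^ 2), -(p 3) / (p 2 ^ 2 + p 3 ^ 2)]))
  /-- the axis of `ηH` is new -/
  ηH_axis : ∀ p : E4, p 2 = 0 → p 3 = 0 → ηH p ∉ range ι
  /-- `ηH` is holomorphic for `i ⊕ i` -/
  ηH_J : ∀ p : E4, p 2 ^ 2 + p 3 ^ 2 < R₁⁻¹ ^ 2 → ∀ q : E4,
    JX (ηH p) (mfderiv 𝓘(ℝ, E4) (𝓡 4) ηH p q) =
      mfderiv 𝓘(ℝ, E4) (𝓡 4) ηH p (WithLp.toLp 2 ![-(q 1), q 0, -(q 3), q 2])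
  /-- the corner chart through `ηV` -/
  ηC_V : ∀ p : E4, p 0 ^ 2 + p 1 ^ 2 < R₁⁻¹ ^ 2 → p 2 ^ 2 + p 3 ^ 2 < R₁⁻¹ ^ 2 →
    (p 2 ≠ 0 ∨ p 3 ≠ 0) →
    ηC p = ηV (WithLp.toLp 2 ![p 0, p 1, p 2 / (p 2 ^ 2 + p 3 ^ 2), -(p 3) / (p 2 ^ 2 + p 3 ^ 2)])
  /-- the corner chart through `ηH` -/
  ηC_H : ∀ p : E4, p 0 ^ 2 + p 1 ^ 2 < R₁⁻¹ ^ 2 → p 2 ^ 2 + p 3 ^ 2 < R₁⁻¹ ^ 2 →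
    (p 0 ≠ 0 ∨ p 1 ≠ 0) →
    ηC p = ηH (WithLp.toLp 2 ![p 0 / (p 0 ^ 2 + p 1 ^ 2), -(p 1) / (p 0 ^ 2 + p 1 ^ 2), p 2, p 3])
  /-- the corner is new -/
  ηC_zero : ηC 0 ∉ range ι
  /-- the pieces cover `X` -/
  cover : ∀ y : X, y ∈ range ι ∨ (∃ p : E4, p 0 ^ 2 + p 1 ^ 2 < R₁⁻¹ ^ 2 ∧ ηV p = y) ∨
    (∃ p : E4, p 2 ^ 2 + p 3 ^ 2 < R₁⁻¹ ^ 2 ∧ ηH p = y) ∨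
    (∃ p : E4, (p 0 ^ 2 + p 1 ^ 2 < R₁⁻¹ ^ 2 ∧ p 2 ^ 2 + p 3 ^ 2 < R₁⁻¹ ^ 2) ∧ ηC p = y)
  /-- `lamV` is smooth -/
  lamV_smooth : ContMDiff (𝓡 4) (𝓡 4) ∞ lamV
  /-- `lamH` is smooth -/
  lamH_smooth : ContMDiff (𝓡 4) (𝓡 4) ∞ lamH
  /-- `lamV` maps into `H∞` -/
  lamV_into : ∀ y : X, (∃ p : E4, p 2 = 0 ∧ p 3 = 0 ∧ ηH p = lamV y) ∨ lamV y = ηC 0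
  /-- `lamV` is the identity on the affine axis of `H∞` -/
  lamV_axis : ∀ p : E4, p 2 = 0 → p 3 = 0 → lamV (ηH p) = ηH p
  /-- `lamH` maps into `V∞` -/
  lamH_into : ∀ y : X, (∃ q : E4, q 0 = 0 ∧ q 1 = 0 ∧ ηV q = lamH y) ∨ lamH y = ηC 0
  /-- `lamH` is the identity on the affine axis of `V∞` -/
  lamH_axis : ∀ q : E4, q 0 = 0 → q 1 = 0 → lamH (ηV q) = ηV q
  /-- corner criterion for `lamV`: `lamV y = ηC 0 ↔ y ∈ V∞` -/
  lamV_corner : ∀ y : X, lamV y = ηC 0 ↔ ((∃ q : E4, q 0 = 0 ∧ q 1 = 0 ∧ ηV q = y) ∨ y = ηC 0)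
  /-- corner criterion for `lamH`: `lamH y = ηC 0 ↔ y ∈ H∞` -/
  lamH_corner : ∀ y : X, lamH y = ηC 0 ↔ ((∃ p : E4, p 2 = 0 ∧ p 3 = 0 ∧ ηH p = y) ∨ y = ηC 0)
  /-- joint injectivity of the labels -/
  inj : ∀ y y' : X, lamV y = lamV y' → lamH y = lamH y' → y = y'
  /-- joint surjectivity of the affine labels -/
  surj : ∀ p q : E4, p 2 = 0 → p 3 = 0 → q 0 = 0 → q 1 = 0 →
    ∃ y : X, lamV y = ηH p ∧ lamH y = ηV q
  /-- the kernel of `d lamV` is `JX`-invariant -/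
  kerV : ∀ (y : X) (v : TangentSpace (𝓡 4) y), mfderiv (𝓡 4) (𝓡 4) lamV y v = 0 →
    mfderiv (𝓡 4) (𝓡 4) lamV y (JX y v) = 0
  /-- the kernel of `d lamH` is `JX`-invariant -/
  kerH : ∀ (y : X) (v : TangentSpace (𝓡 4) y), mfderiv (𝓡 4) (𝓡 4) lamH y v = 0 →
    mfderiv (𝓡 4) (𝓡 4) lamH y (JX y v) = 0
  /-- transversality of the two foliations -/
  trans : ∀ (y : X) (v : TangentSpace (𝓡 4) y), mfderiv (𝓡 4) (𝓡 4) lamV y v = 0 →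
    mfderiv (𝓡 4) (𝓡 4) lamH y v = 0 → v = 0
  /-- positive holonomy of `lamV` -/
  holV : ∀ (y : X) (v : TangentSpace (𝓡 4) y), mfderiv (𝓡 4) (𝓡 4) lamV y v ≠ 0 →
    ∃ α β : ℝ, 0 < β ∧ mfderiv (𝓡 4) (𝓡 4) lamV y (JX y v) =
      α • mfderiv (𝓡 4) (𝓡 4) lamV y v + β • JX (lamV y) (mfderiv (𝓡 4) (𝓡 4) lamV y v)
  /-- positive holonomy of `lamH` -/
  holH : ∀ (y : X) (v : TangentSpace (𝓡 4) y), mfderiv (𝓡 4) (𝓡 4) lamH y v ≠ 0 →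
    ∃ α β : ℝ, 0 < β ∧ mfderiv (𝓡 4) (𝓡 4) lamH y (JX y v) =
      α • mfderiv (𝓡 4) (𝓡 4) lamH y v + β • JX (lamH y) (mfderiv (𝓡 4) (𝓡 4) lamH y v)
  /-- wedge fact: the two affine axes are disjoint -/
  wedge_HV : ∀ p q : E4, p 2 = 0 → p 3 = 0 → q 0 = 0 → q 1 = 0 → ηH p ≠ ηV q
  /-- wedge fact: the affine axis of `H∞` misses the corner -/
  wedge_H : ∀ p : E4, p 2 = 0 → p 3 = 0 → ηH p ≠ ηC 0
  /-- wedge fact: the affine axis of `V∞` misses the corner -/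
  wedge_V : ∀ q : E4, q 0 = 0 → q 1 = 0 → ηV q ≠ ηC 0
  /-- flat leaves of `lamV` -/
  flat_V : ∀ w : E4, R₁ ^ 2 < w 0 ^ 2 + w 1 ^ 2 →
    lamV (ι (χ w)) = ηH (WithLp.toLp 2 ![w 0, w 1, 0, 0])
  /-- flat leaves of `lamH` -/
  flat_H : ∀ w : E4, R₁ ^ 2 < w 2 ^ 2 + w 3 ^ 2 →
    lamH (ι (χ w)) = ηV (WithLp.toLp 2 ![0, 0, w 2, w 3])

/-! ## The two chart domains and the inverse charts -/

/-- `D_H = ℂ × {|t| < R₁⁻¹}`, the domain of `ηH`. [folklore] -/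
def DH (R₁ : ℝ) : Set E4 := {p : E4 | p 2 ^ 2 + p 3 ^ 2 < R₁⁻¹ ^ 2}

/-- `D_V = {|u| < R₁⁻¹} × ℂ`, the domain of `ηV`. [folklore] -/
def DV (R₁ : ℝ) : Set E4 := {p : E4 | p 0 ^ 2 + p 1 ^ 2 < R₁⁻¹ ^ 2}

/-- `D_H` is open. [folklore] -/
theorem isOpen_DH (R₁ : ℝ) : IsOpen (DH R₁) :=
  isOpen_lt (((contDiff_coord 2).pow 2).add ((contDiff_coord 3).pow 2)).continuous continuous_const

/-- `D_V` is open. [folklore] -/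
theorem isOpen_DV (R₁ : ℝ) : IsOpen (DV R₁) :=
  isOpen_lt (((contDiff_coord 0).pow 2).add ((contDiff_coord 1).pow 2)).continuous continuous_const

variable {M X : Type*}

/-- **The inverse `H`-chart** `θH = (ηH|D_H)⁻¹ : X → ℝ⁴` (junk off `ηH '' D_H`). [folklore] -/
def θH (ηH : E4 → X) (R₁ : ℝ) : X → E4 := invFunOn ηH (DH R₁)

/-- **The inverse `V`-chart** `θV = (ηV|D_V)⁻¹ : X → ℝ⁴` (junk off `ηV '' D_V`). [folklore] -/
def θV (ηV : E4 → X) (R₁ : ℝ) : X → E4 := invFunOn ηV (DV R₁)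

/-- **The chart read on `X`**: `Φ y = (z₁(θH (lamV y)), z₂(θV (lamH y)))`. [folklore] -/
def Φ (ηH ηV : E4 → X) (R₁ : ℝ) (lamV lamH : X → X) (y : X) : E4 :=
  P01 (θH ηH R₁ (lamV y)) + P23 (θV ηV R₁ (lamH y))

/-- **The chart `σ` of the stub as a bare function** `σf = Φ ∘ ι : M → ℝ⁴`. [folklore] -/
def σf (ι : M → X) (ηH ηV : E4 → X) (R₁ : ℝ) (lamV lamH : X → X) (x : M) : E4 :=
  Φ ηH ηV R₁ lamV lamH (ι x)

/-- The value of `σf`: coordinates `0,1` of `θH (lamV (ι x))` and `2,3` of `θV (lamH (ι x))`.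
[folklore] -/
theorem σf_apply (ι : M → X) (ηH ηV : E4 → X) (R₁ : ℝ) (lamV lamH : X → X) (x : M) :
    (σf ι ηH ηV R₁ lamV lamH x) 0 = (θH ηH R₁ (lamV (ι x))) 0 ∧
    (σf ι ηH ηV R₁ lamV lamH x) 1 = (θH ηH R₁ (lamV (ι x))) 1 ∧
    (σf ι ηH ηV R₁ lamV lamH x) 2 = (θV ηV R₁ (lamH (ι x))) 2 ∧
    (σf ι ηH ηV R₁ lamV lamH x) 3 = (θV ηV R₁ (lamH (ι x))) 3 :=
  P01_add_P23_apply _ _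

variable [TopologicalSpace M] [ChartedSpace E4 M] [IsManifold (𝓡 4) ∞ M]
  [TopologicalSpace X] [ChartedSpace E4 X] [IsManifold (𝓡 4) ∞ X]
  {J : AlmostComplexStructure (𝓡 4) ∞ M} {JX : AlmostComplexStructure (𝓡 4) ∞ X}
  {ι : M → X} {ηH ηV ηC : E4 → X} {χ : E4 → M} {R₁ : ℝ} {lamV lamH : X → X}

namespace SigmaHyp

variable (h : SigmaHyp J JX ι ηH ηV ηC χ R₁ lamV lamH)
include h

/-! ## Elementary consequences -/

/-- `0 < R₁⁻²`. [folklore] -/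
theorem inv_sq_pos : 0 < R₁⁻¹ ^ 2 := by
  have := h.R₁_pos
  positivity

/-- Points of the affine axis `t = 0` lie in `D_H`. [folklore] -/
theorem mem_DH_of_axis {p : E4} (h2 : p 2 = 0) (h3 : p 3 = 0) : p ∈ DH R₁ := by
  show p 2 ^ 2 + p 3 ^ 2 < R₁⁻¹ ^ 2
  rw [h2, h3]; simpa using h.inv_sq_pos

/-- Points of the affine axis `u = 0` lie in `D_V`. [folklore] -/
theorem mem_DV_of_axis {q : E4} (h0 : q 0 = 0) (h1 : q 1 = 0) : q ∈ DV R₁ := by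
  show q 0 ^ 2 + q 1 ^ 2 < R₁⁻¹ ^ 2
  rw [h0, h1]; simpa using h.inv_sq_pos

/-- `θH ∘ ηH = id` on `D_H`. [folklore] -/
theorem θH_ηH {p : E4} (hp : p ∈ DH R₁) : θH ηH R₁ (ηH p) = p :=
  invFunOn_apply_of_mem h.ηH_inj hp

/-- `θV ∘ ηV = id` on `D_V`. [folklore] -/
theorem θV_ηV {q : E4} (hq : q ∈ DV R₁) : θV ηV R₁ (ηV q) = q :=
  invFunOn_apply_of_mem h.ηV_inj hq

/-- `θH` is `C^∞` at the points of `ηH '' D_H`. [folklore] -/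
theorem contMDiffAt_θH {p : E4} (hp : p ∈ DH R₁) :
    ContMDiffAt (𝓡 4) 𝓘(ℝ, E4) ∞ (θH ηH R₁) (ηH p) :=
  contMDiffAt_invFunOn h.ηH_locDiff (isOpen_DH R₁) h.ηH_inj hp

/-- `θV` is `C^∞` at the points of `ηV '' D_V`. [folklore] -/
theorem contMDiffAt_θV {q : E4} (hq : q ∈ DV R₁) :
    ContMDiffAt (𝓡 4) 𝓘(ℝ, E4) ∞ (θV ηV R₁) (ηV q) :=
  contMDiffAt_invFunOn h.ηV_locDiff (isOpen_DV R₁) h.ηV_inj hq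

/-! ## Points off the spheres at infinity -/

/-- **A point of `ι(M)` is off `V∞`**: `lamV (ι x) ≠ ηC 0`. [folklore] -/
theorem lamV_ι_ne (x : M) : lamV (ι x) ≠ ηC 0 := by
  intro hc
  rcases (h.lamV_corner (ι x)).1 hc with ⟨q, h0, h1, hq⟩ | hx
  · exact h.ηV_axis q h0 h1 ⟨x, hq.symm⟩
  · exact h.ηC_zero ⟨x, hx⟩

/-- **A point of `ι(M)` is off `H∞`**: `lamH (ι x) ≠ ηC 0`. [folklore] -/
theorem lamH_ι_ne (x : M) : lamH (ι x) ≠ ηC 0 := by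
  intro hc
  rcases (h.lamH_corner (ι x)).1 hc with ⟨p, h2, h3, hp⟩ | hx
  · exact h.ηH_axis p h2 h3 ⟨x, hp.symm⟩
  · exact h.ηC_zero ⟨x, hx⟩

/-- Off `V∞` the `V`-label is an affine point of `H∞`: `lamV y = ηH p`, `p` on the axis. [folklore] -/
theorem labelV {y : X} (hy : lamV y ≠ ηC 0) : ∃ p : E4, p 2 = 0 ∧ p 3 = 0 ∧ ηH p = lamV y := by
  rcases h.lamV_into y with hp | hc
  · exact hp
  · exact absurd hc hy

/-- Off `H∞` the `H`-label is an affine point of `V∞`: `lamH y = ηV q`, `q` on the axis. [folklore] -/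
theorem labelH {y : X} (hy : lamH y ≠ ηC 0) : ∃ q : E4, q 0 = 0 ∧ q 1 = 0 ∧ ηV q = lamH y := by
  rcases h.lamH_into y with hq | hc
  · exact hq
  · exact absurd hc hy

/-- Off `V∞`: `θH (lamV y)` is on the axis, in `D_H`, and `ηH (θH (lamV y)) = lamV y`. [folklore] -/
theorem θH_lamV {y : X} (hy : lamV y ≠ ηC 0) :
    (θH ηH R₁ (lamV y)) 2 = 0 ∧ (θH ηH R₁ (lamV y)) 3 = 0 ∧ θH ηH R₁ (lamV y) ∈ DH R₁ ∧
      ηH (θH ηH R₁ (lamV y)) = lamV y := by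
  obtain ⟨p, h2, h3, hp⟩ := h.labelV hy
  have hpD : p ∈ DH R₁ := h.mem_DH_of_axis h2 h3
  rw [← hp, h.θH_ηH hpD]
  exact ⟨h2, h3, hpD, rfl⟩

/-- Off `H∞`: `θV (lamH y)` is on the axis, in `D_V`, and `ηV (θV (lamH y)) = lamH y`. [folklore] -/
theorem θV_lamH {y : X} (hy : lamH y ≠ ηC 0) :
    (θV ηV R₁ (lamH y)) 0 = 0 ∧ (θV ηV R₁ (lamH y)) 1 = 0 ∧ θV ηV R₁ (lamH y) ∈ DV R₁ ∧
      ηV (θV ηV R₁ (lamH y)) = lamH y := by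
  obtain ⟨q, h0, h1, hq⟩ := h.labelH hy
  have hqD : q ∈ DV R₁ := h.mem_DV_of_axis h0 h1
  rw [← hq, h.θV_ηV hqD]
  exact ⟨h0, h1, hqD, rfl⟩

/-- `θH ∘ lamV` is `C^∞` at a point off `V∞`. [folklore] -/
theorem contMDiffAt_θH_lamV {y : X} (hy : lamV y ≠ ηC 0) :
    ContMDiffAt (𝓡 4) 𝓘(ℝ, E4) ∞ (fun y' => θH ηH R₁ (lamV y')) y := by
  obtain ⟨p, h2, h3, hp⟩ := h.labelV hy
  have hθ : ContMDiffAt (𝓡 4) 𝓘(ℝ, E4) ∞ (θH ηH R₁) (lamV y) := by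
    rw [← hp]; exact h.contMDiffAt_θH (h.mem_DH_of_axis h2 h3)
  exact hθ.comp y (h.lamV_smooth y)

/-- `θV ∘ lamH` is `C^∞` at a point off `H∞`. [folklore] -/
theorem contMDiffAt_θV_lamH {y : X} (hy : lamH y ≠ ηC 0) :
    ContMDiffAt (𝓡 4) 𝓘(ℝ, E4) ∞ (fun y' => θV ηV R₁ (lamH y')) y := by
  obtain ⟨q, h0, h1, hq⟩ := h.labelH hy
  have hθ : ContMDiffAt (𝓡 4) 𝓘(ℝ, E4) ∞ (θV ηV R₁) (lamH y) := by
    rw [← hq]; exact h.contMDiffAt_θV (h.mem_DV_of_axis h0 h1)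
  exact hθ.comp y (h.lamH_smooth y)

/-- **`Φ` is `C^∞` at the points off `V∞ ∪ H∞`.** [folklore] -/
theorem contMDiffAt_Φ {y : X} (hV : lamV y ≠ ηC 0) (hH : lamH y ≠ ηC 0) :
    ContMDiffAt (𝓡 4) 𝓘(ℝ, E4) ∞ (Φ ηH ηV R₁ lamV lamH) y :=
  ((P01.contMDiff.contMDiffAt).comp y (h.contMDiffAt_θH_lamV hV)).add
    ((P23.contMDiff.contMDiffAt).comp y (h.contMDiffAt_θV_lamH hH))

/-- **`σf` is `C^∞`.** [folklore] -/
theorem contMDiff_σf : ContMDiff (𝓡 4) 𝓘(ℝ, E4) ∞ (σf ι ηH ηV R₁ lamV lamH) := fun x =>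
  (h.contMDiffAt_Φ (h.lamV_ι_ne x) (h.lamH_ι_ne x)).comp x (h.ι_locDiff x).contMDiffAt

/-! ## Which points of `X` are in `ι(M)` -/

/-- An affine point of `H∞` is on... `H∞`: `lamH (ηH p) = ηC 0` for `p` on the axis. [folklore] -/
theorem lamH_ηH_axis {p : E4} (h2 : p 2 = 0) (h3 : p 3 = 0) : lamH (ηH p) = ηC 0 :=
  (h.lamH_corner _).2 (Or.inl ⟨p, h2, h3, rfl⟩)

/-- `lamV (ηV q) = ηC 0` for `q` on the axis. [folklore] -/
theorem lamV_ηV_axis {q : E4} (h0 : q 0 = 0) (h1 : q 1 = 0) : lamV (ηV q) = ηC 0 :=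
  (h.lamV_corner _).2 (Or.inl ⟨q, h0, h1, rfl⟩)

/-- `lamV (ηC 0) = ηC 0`. [folklore] -/
theorem lamV_zero : lamV (ηC 0) = ηC 0 := (h.lamV_corner _).2 (Or.inr rfl)

/-- A point of `ηV '' D_V` off `V∞` is in `ι(M)`. [folklore] -/
theorem ηV_mem_range {p : E4} (hp : p ∈ DV R₁) (hV : lamV (ηV p) ≠ ηC 0) : ηV p ∈ range ι := by
  by_cases hax : p 0 = 0 ∧ p 1 = 0
  · exact absurd (h.lamV_ηV_axis hax.1 hax.2) hV
  · rw [h.ηV_glue p hp (by tauto)]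
    exact mem_range_self _

/-- A point of `ηH '' D_H` off `H∞` is in `ι(M)`. [folklore] -/
theorem ηH_mem_range {p : E4} (hp : p ∈ DH R₁) (hH : lamH (ηH p) ≠ ηC 0) : ηH p ∈ range ι := by
  by_cases hax : p 2 = 0 ∧ p 3 = 0
  · exact absurd (h.lamH_ηH_axis hax.1 hax.2) hH
  · rw [h.ηH_glue p hp (by tauto)]
    exact mem_range_self _

/-- **A point off `V∞ ∪ H∞` is in `ι(M)`** (the cover clause read through the gluings). [folklore] -/
theorem mem_range_of_ne {y : X} (hV : lamV y ≠ ηC 0) (hH : lamH y ≠ ηC 0) : y ∈ range ι := by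
  rcases h.cover y with hy | ⟨p, hp, rfl⟩ | ⟨p, hp, rfl⟩ | ⟨p, ⟨hp1, hp2⟩, rfl⟩
  · exact hy
  · exact h.ηV_mem_range hp hV
  · exact h.ηH_mem_range hp hH
  · by_cases h23 : p 2 = 0 ∧ p 3 = 0
    · by_cases h01 : p 0 = 0 ∧ p 1 = 0
      · have hp0 : p = 0 := by
          ext i; fin_cases i
          · simpa using h01.1
          · simpa using h01.2
          · simpa using h23.1
          · simpa using h23.2
        rw [hp0] at hV
        exact absurd h.lamV_zero hV
      · rw [h.ηC_H p hp1 hp2 (by tauto)] at hH ⊢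
        refine h.ηH_mem_range ?_ hH
        simp only [DH, mem_setOf_eq]
        simpa using hp2
    · rw [h.ηC_V p hp1 hp2 (by tauto)] at hV ⊢
      refine h.ηV_mem_range ?_ hV
      simp only [DV, mem_setOf_eq]
      simpa using hp1

end SigmaHyp

end ReadSigma

/-- **Registered helper sub-goal `helper_readSigmaAxisChart`** (second auxiliary file of stub
`stub_readSigma`): for `R₁ > 0` the points of the affine axis `t = 0` lie in the chart domain
`D_H = {|t| < R₁⁻¹}`, so the inverse chart `invFunOn η D_H` of a map `η` injective on `D_H` reads
them correctly. [folklore] -/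
theorem helper_readSigmaAxisChart : ∀ (X : Type) (η : EuclideanSpace ℝ (Fin 4) → X) (R₁ : ℝ),
    0 < R₁ → Set.InjOn η {p : EuclideanSpace ℝ (Fin 4) | p 2 ^ 2 + p 3 ^ 2 < R₁⁻¹ ^ 2} →
    ∀ p : EuclideanSpace ℝ (Fin 4), p 2 = 0 → p 3 = 0 →
    Function.invFunOn η {p : EuclideanSpace ℝ (Fin 4) | p 2 ^ 2 + p 3 ^ 2 < R₁⁻¹ ^ 2} (η p) = p := by
  intro X η R₁ hR hinj p h2 h3
  refine ReadSigma.invFunOn_apply_of_mem hinj ?_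
  show p 2 ^ 2 + p 3 ^ 2 < R₁⁻¹ ^ 2
  rw [h2, h3]
  have : 0 < R₁⁻¹ ^ 2 := by positivity
  simpa using this

end Summit.SmoothPoincare4.SmoothPoincare4.Theorems.GromovRecognitionRelEnd.CrossCapLaurent

end
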